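import Summits.QuantumAdvantage.AdviceFreeQNC0.AffBells26TargetFormula
import Mathlib.Algebra.BigOperators.Group.Finset.Powerset
import HarnessLib

/-!
# Q1' of the flip-cube sieve: `AffBells26.CubeTarget` PROVED (planner qn-p1 g26, ROUND-25 §5; ask P-26 (c))

Prover seat qn-prover-3 g14.  **`cubeTarget : CubeTarget`** — along an admissible flip cube `(x, A)` with `|A| ≥ 2` the targets
`N + Z(x_S) + p(x_S)` of the `2^{|A|}` inputs `x_S`, `S ⊆ A`, sum to `0 (mod 2)`.

Proof.  `kline_xS` (iterated `Fib19.kline_create`): for `S ⊆ A`, `x_S` is odd and `kline x_S = flipAt (kline x) S` — the creations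
in `S` commute (their flip pairs `{a−1, a+1}` are pairwise disjoint by the distance-`≥ 3` clause of `Admissible`) and each turns the
active position `a` into a coin.  Hence (`zeros_flipAt_of_true`) `Z(x_S) = Z + |S|` and (`pairs2_flipAt`)
`p(x_S) = p + #{a ∈ S : J_{a+2} coin} + #{a ∈ S : J_{a−2} coin}` (no two members of `S` are at distance `2`): the target is AFFINE in
`S`, `T(S) = T(∅) + Σ_{a ∈ S} (1 + q_a)`.  Splitting the cube along one `a₀ ∈ A` (`Finset.sum_powerset_insert`) the sum is
`2·Σ_{S ⊆ A∖a₀} T(S) + 2^{|A|−1}(1 + q_{a₀})`, even as `|A| ≥ 2`.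

WHAT THIS IS NOT: instrument for the (NP₀) rung of crux stmt-QuantumAdvantage-22907 (route DWalkThree); Q1 (`CubeIdentity`), Q2, Q3 NOT
proved here; separation NOT moved.
-/

namespace Summit.QuantumAdvantage.AdviceFreeQNC0

namespace AffBells26

open Finset Literature.Computability.QuantumComplexity Literature.Computability.QuantumComplexity.RingHLF
open AffBells23 Fib19

variable {N : ℕ}

/-! ### Flip algebra -/

/-- Flipping on two disjoint sets one after the other is flipping on the union. -/
theorem flipAt_flipAt_of_disjoint (x : Fin N → Bool) {S T : Finset (Fin N)} (h : Disjoint S T) :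
    flipAt (flipAt x S) T = flipAt x (S ∪ T) := by
  funext i
  unfold flipAt
  by_cases hS : i ∈ S
  · have hT : i ∉ T := fun hT => disjoint_left.1 h hS hT
    simp [hS, hT]
  · by_cases hT : i ∈ T
    · simp [hS, hT]
    · simp [hS, hT]

/-- Flipping on the empty set does nothing. -/
theorem flipAt_empty' (x : Fin N → Bool) : flipAt x ∅ = x := by
  funext i; simp [flipAt]

/-- The flip set of `insert a S`. -/
theorem flipSet_insert (a : Fin N) (S : Finset (Fin N)) : flipSet (insert a S) = {prv a, nxt a} ∪ flipSet S := by
  unfold flipSet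
  rw [biUnion_insert]

/-- The flip set of the empty cube. -/
theorem flipSet_empty : flipSet (∅ : Finset (Fin N)) = ∅ := by
  unfold flipSet
  rw [biUnion_empty]

/-! ### Admissibility bookkeeping -/

/-- In an admissible cube, the flip pair of `a` misses the flip set of the other creations. -/
theorem disjoint_flipSet {x : Fin N → Bool} {A : Finset (Fin N)} (hA : Admissible x A) {a : Fin N} (ha : a ∈ A)
    {S : Finset (Fin N)} (hS : S ⊆ A) (haS : a ∉ S) : Disjoint (flipSet S) {prv a, nxt a} := by
  rw [disjoint_right]
  intro i hi hiS
  unfold flipSet at hiS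
  rw [mem_biUnion] at hiS
  obtain ⟨a', ha'S, hi'⟩ := hiS
  have ha' : a' ∈ A := hS ha'S
  have hne : a ≠ a' := fun h => haS (h ▸ ha'S)
  obtain ⟨h1, h2, h3, h4⟩ := hA.2 a ha a' ha' hne
  rw [mem_insert, mem_singleton] at hi hi'
  rcases hi with rfl | rfl <;> rcases hi' with h | h
  · exact hne (prv_injective h)
  · exact h4 (by rw [h]; exact (prv_nxt a').symm)
  · exact h2 (by rw [h]; exact (nxt_prv a').symm)
  · exact hne (nxt_injective h)

/-- In an admissible cube, `a`, `a−1`, `a+1` are not among the other creation centres. -/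
theorem not_mem_of_admissible {x : Fin N → Bool} {A : Finset (Fin N)} (hA : Admissible x A) {a : Fin N} (ha : a ∈ A)
    {S : Finset (Fin N)} (hS : S ⊆ A) (haS : a ∉ S) : prv a ∉ S ∧ nxt a ∉ S := by
  constructor
  · intro h
    have hne : a ≠ prv a := fun e => haS (e ▸ h)
    exact (hA.2 a ha (prv a) (hS h) hne).2.2.1 rfl
  · intro h
    have hne : a ≠ nxt a := fun e => haS (e ▸ h)
    exact (hA.2 a ha (nxt a) (hS h) hne).1 rfl

/-! ### Iterated creation -/

/-- **Iterated coin creation**: for `S ⊆ A` admissible, `x_S` is odd and its kernel line is `kline x` with the coins `S` added. -/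
theorem kline_xS (hN : 5 ≤ N) (x : Fin N → Bool) (hodd : IsOdd x) {A : Finset (Fin N)} (hA : Admissible x A) :
    ∀ S, S ⊆ A → IsOdd (xS x S) ∧ kline (xS x S) = flipAt (kline x) S := by
  classical
  intro S
  induction S using Finset.induction_on with
  | empty =>
    intro _
    unfold xS
    rw [flipSet_empty, flipAt_empty', flipAt_empty']
    exact ⟨hodd, rfl⟩
  | insert a S haS ih =>
    intro hsub
    have ha : a ∈ A := hsub (mem_insert_self a S)
    have hS : S ⊆ A := fun i hi => hsub (mem_insert_of_mem hi)
    obtain ⟨hoddS, hkS⟩ := ih hS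
    obtain ⟨hp, hn'⟩ := not_mem_of_admissible hA ha hS haS
    have hxS : xS x (insert a S) = flipAt (xS x S) {prv a, nxt a} := by
      unfold xS
      rw [flipSet_insert, union_comm, flipAt_flipAt_of_disjoint x (disjoint_flipSet hA ha hS haS)]
    obtain ⟨h1, h2, h3⟩ := hA.1 a ha
    have hc := kline_create (by omega) (xS x S) hoddS a
      (by rw [hkS, flipAt_apply_of_not_mem hp, h1]) (by rw [hkS, flipAt_apply_of_not_mem haS, h2])
      (by rw [hkS, flipAt_apply_of_not_mem hn', h3])
    rw [hxS]
    refine ⟨hc.1, ?_⟩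
    rw [hc.2, hkS, flipAt_flipAt_of_disjoint _ (disjoint_singleton_right.2 haS), union_comm, ← insert_eq]

/-! ### Coins and distance-two pairs after the creations -/

/-- Creating coins at active positions adds `|S|` coins. -/
theorem zeros_flipAt_of_true (J : Fin N → Bool) (S : Finset (Fin N)) (h : ∀ a ∈ S, J a = true) :
    zeros (flipAt J S) = zeros J + S.card := by
  unfold zeros
  have e : (univ.filter fun i : Fin N => flipAt J S i = false) = (univ.filter fun i : Fin N => J i = false) ∪ S := by
    ext i
    rw [mem_union, mem_filter, mem_filter]
    simp only [mem_univ, true_and]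
    by_cases hi : i ∈ S
    · rw [flipAt_apply_of_mem hi, h i hi]; simp [hi]
    · rw [flipAt_apply_of_not_mem hi]; simp [hi]
  rw [e, card_union_of_disjoint]
  rw [disjoint_right]
  intro i hi hi'
  rw [mem_filter] at hi'
  rw [h i hi] at hi'
  exact Bool.noConfusion hi'.2

/-- Distance-two coin pairs after the creations: the old pairs, plus one for each created coin with an old coin two steps ahead,
plus one for each created coin with an old coin two steps behind (no two creations are at distance two). -/
theorem pairs2_flipAt (J : Fin N → Bool) (S : Finset (Fin N)) (hJ : ∀ a ∈ S, J a = true)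
    (hsep : ∀ a ∈ S, nxt (nxt a) ∉ S) :
    pairs2 (flipAt J S) = pairs2 J + (S.filter fun a => J (nxt (nxt a)) = false).card +
      (S.filter fun a => J (prv (prv a)) = false).card := by
  classical
  set F₀ := univ.filter fun i : Fin N => J i = false ∧ J (nxt (nxt i)) = false with hF₀
  set F₁ := univ.filter fun i : Fin N => i ∈ S ∧ J (nxt (nxt i)) = false with hF₁
  set F₂ := univ.filter fun i : Fin N => nxt (nxt i) ∈ S ∧ J i = false with hF₂
  have hsep' : ∀ i, nxt (nxt i) ∈ S → i ∉ S := fun i h hi => hsep i hi h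
  have e : (univ.filter fun i : Fin N => flipAt J S i = false ∧ flipAt J S (nxt (nxt i)) = false) = F₀ ∪ F₁ ∪ F₂ := by
    ext i
    rw [mem_union, mem_union, hF₀, hF₁, hF₂, mem_filter, mem_filter, mem_filter, mem_filter]
    simp only [mem_univ, true_and]
    by_cases hi : i ∈ S
    · have hnn : nxt (nxt i) ∉ S := hsep i hi
      rw [flipAt_apply_of_mem hi, flipAt_apply_of_not_mem hnn, hJ i hi]
      simp [hi, hnn]
    · by_cases hnn : nxt (nxt i) ∈ S
      · rw [flipAt_apply_of_not_mem hi, flipAt_apply_of_mem hnn, hJ _ hnn]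
        simp [hi, hnn]
      · rw [flipAt_apply_of_not_mem hi, flipAt_apply_of_not_mem hnn]
        simp [hi, hnn]
  have d01 : Disjoint F₀ F₁ := by
    rw [disjoint_left]; intro i h0 h1
    rw [hF₀, mem_filter] at h0; rw [hF₁, mem_filter] at h1
    rw [hJ i h1.2.1] at h0; exact Bool.noConfusion h0.2.1
  have d02 : Disjoint F₀ F₂ := by
    rw [disjoint_left]; intro i h0 h2
    rw [hF₀, mem_filter] at h0; rw [hF₂, mem_filter] at h2
    rw [hJ _ h2.2.1] at h0; exact Bool.noConfusion h0.2.2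
  have d12 : Disjoint F₁ F₂ := by
    rw [disjoint_left]; intro i h1 h2
    rw [hF₁, mem_filter] at h1; rw [hF₂, mem_filter] at h2
    exact hsep i h1.2.1 h2.2.1
  have c1 : F₁.card = (S.filter fun a => J (nxt (nxt a)) = false).card := by
    rw [hF₁]; congr 1; ext i; simp
  have c2 : F₂.card = (S.filter fun a => J (prv (prv a)) = false).card := by
    have step : F₂.card = (univ.filter fun j : Fin N => j ∈ S ∧ J (prv (prv j)) = false).card := by
      rw [hF₂, ← card_filter_comp (fun i => nxt (nxt i)) (fun i => prv (prv i))
        (fun i => by simp only [nxt_prv]) (fun i => by simp only [prv_nxt])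
        (fun j => j ∈ S ∧ J (prv (prv j)) = false)]
      congr 1
      ext i
      simp only [mem_filter, mem_univ, true_and, prv_nxt]
    rw [step]
    congr 1
    ext i
    simp
  unfold pairs2
  rw [e, card_union_of_disjoint (disjoint_union_left.2 ⟨d02, d12⟩), card_union_of_disjoint d01, c1, c2]

/-! ### The affine target and the cube sum -/

/-- The target of `x_S` along an admissible cube: `T(S) = N + (Z + |S|) + (p + c⁺(S) + c⁻(S))`. -/
theorem target_xS (hN : 5 ≤ N) (x : Fin N → Bool) (hodd : IsOdd x) {A : Finset (Fin N)} (hA : Admissible x A)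
    {S : Finset (Fin N)} (hS : S ⊆ A) :
    zeros (kline (xS x S)) + pairs2 (kline (xS x S)) =
      zeros (kline x) + S.card + (pairs2 (kline x) + (S.filter fun a => kline x (nxt (nxt a)) = false).card +
        (S.filter fun a => kline x (prv (prv a)) = false).card) := by
  have hk := (kline_xS hN x hodd hA S hS).2
  have hJ : ∀ a ∈ S, kline x a = true := fun a ha => (hA.1 a (hS ha)).2.1
  have hsep : ∀ a ∈ S, nxt (nxt a) ∉ S := by
    intro a ha h
    have hne : a ≠ nxt (nxt a) := by
      intro e
      have := (hA.1 a (hS ha)).2.1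
      exact nxt_iterate_ne_self a (j := 2) (by norm_num) (by omega) (by simpa using e.symm)
    exact (hA.2 a (hS ha) (nxt (nxt a)) (hS h) hne).2.1 rfl
  rw [hk, zeros_flipAt_of_true _ _ hJ, pairs2_flipAt _ _ hJ hsep]

/-- **Q1', `CubeTarget`**: along an admissible cube with `|A| ≥ 2` the targets sum to `0 (mod 2)`. -/
theorem cubeTarget : CubeTarget := by
  classical
  intro N hN x A hodd hA hcard
  -- split along some a₀ ∈ A
  obtain ⟨a₀, ha₀⟩ : A.Nonempty := card_pos.1 (by omega)
  set A' := A.erase a₀ with hA'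
  have hAeq : A = insert a₀ A' := by rw [hA', insert_erase ha₀]
  have ha₀' : a₀ ∉ A' := by rw [hA']; exact notMem_erase a₀ A
  have hA'card : 1 ≤ A'.card := by rw [hA', card_erase_of_mem ha₀]; omega
  -- the increment of the target along a₀
  set q : ℕ := (if kline x (nxt (nxt a₀)) = false then 1 else 0) + (if kline x (prv (prv a₀)) = false then 1 else 0) with hq
  have hstep : ∀ S ∈ A'.powerset,
      N + zeros (kline (xS x (insert a₀ S))) + pairs2 (kline (xS x (insert a₀ S))) =
        N + zeros (kline (xS x S)) + pairs2 (kline (xS x S)) + (1 + q) := by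
    intro S hS
    rw [mem_powerset] at hS
    have hS' : S ⊆ A := fun i hi => mem_of_mem_erase (hS hi)
    have hSa : insert a₀ S ⊆ A := insert_subset ha₀ hS'
    have haS : a₀ ∉ S := fun h => ha₀' (hS h)
    have h1 := target_xS hN x hodd hA hSa
    have h2 := target_xS hN x hodd hA hS'
    have hnm1 : a₀ ∉ S.filter (fun a => kline x (nxt (nxt a)) = false) := fun h => haS (mem_filter.1 h).1
    have hnm2 : a₀ ∉ S.filter (fun a => kline x (prv (prv a)) = false) := fun h => haS (mem_filter.1 h).1
    rw [card_insert_of_notMem haS, filter_insert, filter_insert] at h1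
    by_cases hp : kline x (nxt (nxt a₀)) = false <;> by_cases hp' : kline x (prv (prv a₀)) = false
    · rw [if_pos hp, if_pos hp', card_insert_of_notMem hnm1, card_insert_of_notMem hnm2] at h1
      rw [if_pos hp, if_pos hp'] at hq
      omega
    · rw [if_pos hp, if_neg hp', card_insert_of_notMem hnm1] at h1
      rw [if_pos hp, if_neg hp'] at hq
      omega
    · rw [if_neg hp, if_pos hp', card_insert_of_notMem hnm2] at h1
      rw [if_neg hp, if_pos hp'] at hq
      omega
    · rw [if_neg hp, if_neg hp'] at h1
      rw [if_neg hp, if_neg hp'] at hq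
      omega
  have hsum2 : ∑ S ∈ A'.powerset, (N + zeros (kline (xS x S)) + pairs2 (kline (xS x S)) + (1 + q)) =
      ∑ S ∈ A'.powerset, (N + zeros (kline (xS x S)) + pairs2 (kline (xS x S))) + 2 ^ A'.card * (1 + q) := by
    rw [sum_add_distrib, sum_const, card_powerset, smul_eq_mul]
  rw [hAeq, sum_powerset_insert ha₀', sum_congr rfl hstep, hsum2]
  -- 2·Σ + 2^{|A'|}·(1+q) is even
  obtain ⟨m, hm⟩ : ∃ m, A'.card = m + 1 := ⟨A'.card - 1, by omega⟩
  obtain ⟨K, hK⟩ : ∃ K, 2 ^ A'.card * (1 + q) = 2 * K := ⟨2 ^ m * (1 + q), by rw [hm, pow_succ]; ring⟩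
  rw [hK]
  omega

end AffBells26

end Summit.QuantumAdvantage.AdviceFreeQNC0
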